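import Mathlib
import HarnessLib
import Literature.Computability.AlgebraicComplexity.IMMWalkExpansion
import Literature.Computability.AlgebraicComplexity.AutomatonIMM

/-!
# Route SchenstedIndex — tools for the crux `PowTraceCertificate` (stmt-ValiantsHypothesis-15995)

Helper file (theorem-only) for `Theorems/SchenstedIndexPowTraceCertificate.lean`, which proves the
crux `Summit.ValiantsHypothesis.ValiantsHypothesis.Theses.SchenstedIndex.PowTraceCertificate` by SLOT
POLARISATION (crux idea card `Cruxes/PowTraceCertificate/Ideas/slot-polarisation-imm-pullback.md`,
refuter vetting 2026-08-17). Slots `S = Fin t × Fin m × Fin m` carry labels `(i,j) ∈ Fin m × Fin m`;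
`θ : ℂ[x_(i,j)] → ℂ[y_s]` is the algebra map `x_(i,j) ↦ ∑_k y_(k,i,j)`; for a block `B ⊆ S` of size
`m` the functional `E_B` is the coefficient of the square-free monomial `y^B`.

Contents (all elementary, finite sums with explicit indices):
* `coeff_indicator_prod_linearForms` — the square-free coefficient of a product of `m` linear forms
  `∏_i ∑_s c_(i,s) y_s` at `y^B` is `∑_(q : Fin m ≃ B) ∏_i c_(i, q i)` (bijective words only;
  `sum_single_eq_sum_single_iff`).
* `trace_pow_eq_sum_closedWalks` — `tr(M^m) = ∑_(v : Fin m → Fin n) ∏_i M_(v i, v (i+1))`, pulled back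
  from the tree's `IMMWalk.immPoly_eq_sum_closedWalks` along `LayeredAutomaton.aeval_immPoly_eq_trace`;
  `coeff_indicator_trace_pencil_pow` — the block coefficient of the power trace of a slot pencil
  `Ã = ∑_s y_s N_s` is `∑_v ∑_(q : Fin m ≃ B) ∏_i (N_(q i))_(v i, v (i+1))`.
* `sum_prod_parts_eq_prod_sum` — Fubini over the blocks of a `Finpartition` (restriction
  equivalence `(S → X) ≃ Π_(B ∈ π) (B → X)` via `Finpartition.equivSigmaParts`);
  `sum_arrow_eq_sum_comp` — reindexing along a bijection `q : Fin m ≃ B`.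
* `rank_slotMatrix_le` — the slot matrix `X_ρ(s,s') = (N_s)_(ρ s, ρ s')` has rank `≤ n`.
* `coeff_indicator_theta_perPoly` — `E_B(θ per_m) = [B has m distinct rows and m distinct columns]`.
* `eq_sum_coeff_single_mul_X`, `map_theta_eq_pencil` — linear entries: `θ` applied entrywise to a
  matrix of linear forms is the slot pencil with `N_(k,ℓ) = ∂A/∂x_ℓ`.

HONEST FRAMING: bookkeeping for the SOUNDNESS direction of the route's certificate scheme; nothing
here bears on `VP ≠ VNP`.  This module is ROUTE-INDEPENDENT (it does not import the route file
`Theses/SchenstedIndex.lean`), so other Theorems files may build on it.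
-/

set_option linter.dupNamespace false

noncomputable section

namespace Summit.ValiantsHypothesis.ValiantsHypothesis.Theorems.SchenstedIndex

open MvPolynomial
open Literature.Computability.AlgebraicComplexity

/-! ## 1. Square-free coefficients of products of linear forms -/

/-- A word `w : Fin m → S` has exponent vector equal to the indicator of a set `B` of size `m` iff it
is injective with values in `B` (i.e. a bijection onto `B`). -/
theorem sum_single_eq_sum_single_iff {S : Type*} [DecidableEq S] {m : ℕ} (B : Finset S)
    (hB : B.card = m) (w : Fin m → S) :
    ((∑ i, Finsupp.single (w i) 1 : S →₀ ℕ) = ∑ s ∈ B, Finsupp.single s 1) ↔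
      (Function.Injective w ∧ ∀ i, w i ∈ B) := by
  classical
  have hcount : ∀ s : S, ((∑ i, Finsupp.single (w i) 1 : S →₀ ℕ) s) =
      (Finset.univ.filter fun i => w i = s).card := by
    intro s
    rw [Finsupp.finsetSum_apply, Finset.card_filter]
    refine Finset.sum_congr rfl fun i _ => ?_
    rw [Finsupp.single_apply]
  have hind : ∀ s : S, ((∑ s' ∈ B, Finsupp.single s' 1 : S →₀ ℕ) s) = if s ∈ B then 1 else 0 := by
    intro s
    rw [Finsupp.finsetSum_apply]
    simp_rw [Finsupp.single_apply]
    rw [Finset.sum_ite_eq']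
  constructor
  · intro h
    have h' : ∀ s, (Finset.univ.filter fun i => w i = s).card = if s ∈ B then 1 else 0 := fun s => by
      rw [← hcount, ← hind, h]
    have hmem : ∀ i, w i ∈ B := by
      intro i
      by_contra hi
      have h1 := h' (w i)
      rw [if_neg hi] at h1
      have : i ∈ Finset.univ.filter fun j => w j = w i := Finset.mem_filter.2 ⟨Finset.mem_univ _, rfl⟩
      rw [Finset.card_eq_zero.1 h1] at this
      exact absurd this (Finset.notMem_empty _)
    refine ⟨fun i j hij => ?_, hmem⟩
    have h1 := h' (w j)
    have hle : (Finset.univ.filter fun k => w k = w j).card ≤ 1 := by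
      rw [h1]; split_ifs <;> omega
    exact Finset.card_le_one.1 hle i (Finset.mem_filter.2 ⟨Finset.mem_univ _, hij⟩) j
      (Finset.mem_filter.2 ⟨Finset.mem_univ _, rfl⟩)
  · rintro ⟨hinj, hmem⟩
    ext s
    rw [hcount, hind]
    by_cases hs : s ∈ B
    · rw [if_pos hs]
      have himg : Finset.univ.image w = B := by
        refine Finset.eq_of_subset_of_card_le (fun x hx => ?_) ?_
        · obtain ⟨i, -, rfl⟩ := Finset.mem_image.1 hx
          exact hmem i
        · rw [Finset.card_image_of_injective _ hinj, Finset.card_univ, Fintype.card_fin, hB]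
      obtain ⟨i, -, hi⟩ := Finset.mem_image.1 (himg ▸ hs : s ∈ Finset.univ.image w)
      have hle : (Finset.univ.filter fun k => w k = s).card ≤ 1 :=
        Finset.card_le_one.2 fun a ha b hb =>
          hinj ((Finset.mem_filter.1 ha).2.trans (Finset.mem_filter.1 hb).2.symm)
      have hpos : 0 < (Finset.univ.filter fun k => w k = s).card :=
        Finset.card_pos.2 ⟨i, Finset.mem_filter.2 ⟨Finset.mem_univ _, hi⟩⟩
      omega
    · rw [if_neg hs, Finset.card_eq_zero, Finset.filter_eq_empty_iff]
      intro i _ hi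
      exact hs (hi ▸ hmem i)

/-- **Square-free coefficient of a product of linear forms.** For a set `B` of `m` variables, the
coefficient of the square-free monomial `∏_(s ∈ B) y_s` in `∏_(i < m) ∑_s c_(i,s) y_s` is the sum
over the bijections `q : Fin m ≃ B` of `∏_i c_(i, q i)`. -/
theorem coeff_indicator_prod_linearForms {S R : Type*} [DecidableEq S] [Fintype S] [CommSemiring R]
    {m : ℕ} (B : Finset S) (hB : B.card = m) (c : Fin m → S → R) :
    coeff (∑ s ∈ B, Finsupp.single s 1) (∏ i : Fin m, ∑ s : S, C (c i s) * X s) =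
      ∑ q : Fin m ≃ ↥B, ∏ i, c i (q i) := by
  classical
  rw [Fintype.prod_sum]
  have hterm : ∀ w : Fin m → S, (∏ i, C (c i (w i)) * X (w i) : MvPolynomial S R) =
      monomial (∑ i, Finsupp.single (w i) 1) (∏ i, c i (w i)) := by
    intro w
    rw [Finset.prod_mul_distrib, ← map_prod C,
      show (∏ i, X (w i) : MvPolynomial S R) = monomial (∑ i, Finsupp.single (w i) 1) 1 by
        rw [monomial_sum_one]; rfl,
      C_mul_monomial, mul_one]
  simp_rw [hterm, coeff_sum, coeff_monomial, sum_single_eq_sum_single_iff B hB]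
  rw [← Finset.sum_filter]
  symm
  refine Finset.sum_bij (fun q _ => fun i => ((q i : ↥B) : S)) ?_ ?_ ?_ ?_
  · intro q _
    exact Finset.mem_filter.2 ⟨Finset.mem_univ _,
      Subtype.val_injective.comp q.injective, fun i => (q i).2⟩
  · intro q₁ _ q₂ _ h
    exact Equiv.ext fun i => Subtype.ext (congr_fun h i)
  · intro w hw
    obtain ⟨-, hinj, hmem⟩ := Finset.mem_filter.1 hw
    have hbij : Function.Bijective (fun i => (⟨w i, hmem i⟩ : ↥B)) := by
      rw [Fintype.bijective_iff_injective_and_card]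
      exact ⟨fun i j hij => hinj (congr_arg Subtype.val hij), by simp [hB]⟩
    exact ⟨Equiv.ofBijective _ hbij, Finset.mem_univ _, rfl⟩
  · intro q _
    rfl

/-! ## 2. Power traces are closed-walk sums -/

/-- `tr(M^m) = ∑_(v : Fin m → Fin n) ∏_i M_(v i, v (i+1 mod m))` for `m ≥ 1` — the closed-walk
expansion of a power trace, pulled back from the tree's expansion of `IMM` along the constant-layer
substitution. -/
theorem trace_pow_eq_sum_closedWalks {R : Type*} [CommSemiring R] {n m : ℕ} (hm : 0 < m)
    (M : Matrix (Fin n) (Fin n) R) :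
    (M ^ m).trace = ∑ v : Fin m → Fin n, ∏ i : Fin m, M (v i) (v (finRotate m i)) := by
  have h := LayeredAutomaton.aeval_immPoly_eq_trace (K := R) (d := m) (n := n) (S := R)
    (fun x => M x.2.1 x.2.2)
  have hl : (List.map (fun _ : Fin m => Matrix.of fun i j => M i j) (List.finRange m)) =
      List.replicate m M := by
    rw [List.map_const', List.length_finRange]
    rfl
  rw [hl, List.prod_replicate] at h
  rw [← h, IMMWalk.immPoly_eq_sum_closedWalks n m R hm, map_sum]
  refine Finset.sum_congr rfl fun v _ => ?_
  rw [← IMMWalk.prod_X_closedWalk, map_prod]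
  simp only [aeval_X]

/-- The square-free block coefficient of the power trace of a slot pencil `Ã = ∑_s y_s N_s`:
`coeff_(y^B) tr(Ã^m) = ∑_(v : Fin m → Fin n) ∑_(q : Fin m ≃ B) ∏_i (N_(q i))_(v i, v (i+1))`. -/
theorem coeff_indicator_trace_pencil_pow {S R : Type*} [DecidableEq S] [Fintype S] [CommSemiring R]
    {n m : ℕ} (hm : 0 < m) (N : S → Matrix (Fin n) (Fin n) R) (B : Finset S) (hB : B.card = m) :
    coeff (∑ s ∈ B, Finsupp.single s 1)
        ((Matrix.of fun a b : Fin n => ∑ s : S, C (N s a b) * (X s : MvPolynomial S R)) ^ m).trace =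
      ∑ v : Fin m → Fin n, ∑ q : Fin m ≃ ↥B, ∏ i, N (q i) (v i) (v (finRotate m i)) := by
  rw [trace_pow_eq_sum_closedWalks hm, coeff_sum]
  refine Finset.sum_congr rfl fun v _ => ?_
  simp only [Matrix.of_apply]
  exact coeff_indicator_prod_linearForms B hB (fun i s => N s (v i) (v (finRotate m i)))

/-! ## 3. Fubini over the blocks of a partition; reindexing along a bijection -/

/-- Summing a product of block-local quantities over all maps `ρ : S → X` factors over the blocks
of a partition of `S`: `∑_ρ ∏_(B ∈ π) g_B(ρ|_B) = ∏_(B ∈ π) ∑_(r : B → X) g_B(r)`. -/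
theorem sum_prod_parts_eq_prod_sum {S X R : Type*} [DecidableEq S] [Fintype S] [Fintype X]
    [DecidableEq X] [CommSemiring R] (π : Finpartition (Finset.univ : Finset S))
    (g : (B : Finset S) → (↥B → X) → R) :
    ∑ ρ : S → X, ∏ B ∈ π.parts, g B (fun s => ρ s) = ∏ B ∈ π.parts, ∑ r : ↥B → X, g B r := by
  classical
  -- the restriction equivalence `(S → X) ≃ Π (B : π.parts), (B → X)`
  let Φ : (S → X) ≃ ((B : ↥π.parts) → (↥(B : Finset S) → X)) :=
    ((Equiv.subtypeUnivEquiv (fun x : S => Finset.mem_univ x)).symm.arrowCongr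
        (Equiv.refl X)).trans
      ((π.equivSigmaParts.arrowCongr (Equiv.refl X)).trans
        (Equiv.piCurry fun (B : ↥π.parts) (_ : ↥(B : Finset S)) => X))
  have hR : (∏ B ∈ π.parts, ∑ r : ↥B → X, g B r) =
      ∑ R : ((B : ↥π.parts) → (↥(B : Finset S) → X)), ∏ B : ↥π.parts, g B (R B) := by
    rw [← Finset.prod_coe_sort π.parts (fun B => ∑ r : ↥B → X, g B r)]
    exact Fintype.prod_sum (fun (B : ↥π.parts) (r : ↥(B : Finset S) → X) => g B r)
  have hL : ∀ ρ : S → X, (∏ B ∈ π.parts, g B (fun s => ρ s)) = ∏ B : ↥π.parts, g B (Φ ρ B) := by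
    intro ρ
    rw [← Finset.prod_coe_sort π.parts (fun B => g B (fun s : ↥B => ρ s))]
    rfl
  rw [hR, Finset.sum_congr rfl (fun ρ _ => hL ρ)]
  exact Φ.sum_comp (fun R => ∏ B : ↥π.parts, g B (R B))

/-- Reindexing a sum over maps `r : B → X` along a bijection `q : Fin m ≃ B`. -/
theorem sum_arrow_eq_sum_comp {X R : Type*} [Fintype X] [DecidableEq X] [AddCommMonoid R] {m : ℕ}
    {B : Type*} [Fintype B] [DecidableEq B] (q : Fin m ≃ B) (G : (Fin m → X) → R) :
    ∑ r : B → X, G (fun i => r (q i)) = ∑ v : Fin m → X, G v := by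
  rw [← (q.symm.arrowCongr (Equiv.refl X)).sum_comp G]
  rfl

/-! ## 4. Slot matrices have rank `≤ n` -/

/-- The slot matrix `X_ρ(s,s') = (N_s)_(ρ s, ρ s')` factors through `ℂ^n`, so its rank is `≤ n`. -/
theorem rank_slotMatrix_le {S : Type*} [DecidableEq S] [Fintype S] {n : ℕ}
    (N : S → Matrix (Fin n) (Fin n) ℂ) (ρ : S → Fin n) :
    (Matrix.of fun s s' : S => N s (ρ s) (ρ s')).rank ≤ n := by
  classical
  have hfac : (Matrix.of fun s s' : S => N s (ρ s) (ρ s')) =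
      (Matrix.of fun (s : S) (b : Fin n) => N s (ρ s) b) *
        (Matrix.of fun (b : Fin n) (s' : S) => if ρ s' = b then (1 : ℂ) else 0) := by
    ext s s'
    rw [Matrix.mul_apply]
    simp only [Matrix.of_apply, mul_ite, mul_one, mul_zero]
    rw [Finset.sum_ite_eq]
    simp
  rw [hfac]
  refine (Matrix.rank_mul_le_left _ _).trans ?_
  exact (Matrix.rank_le_card_width _).trans (by simp)

/-! ## 5. The per side: block coefficients of `θ(per_m)` -/

/-- The polarised variable: `∑_s [label s = ℓ] y_s = ∑_k y_(k,ℓ)`. -/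
theorem sum_ite_label_eq {t m : ℕ} {R : Type*} [CommSemiring R] (ℓ : Fin m × Fin m) :
    (∑ s : Fin t × Fin m × Fin m, C (if s.2 = ℓ then (1 : R) else 0) * X s :
      MvPolynomial (Fin t × Fin m × Fin m) R) = ∑ k : Fin t, X (k, ℓ) := by
  rw [Fintype.sum_prod_type]
  refine Finset.sum_congr rfl fun k _ => ?_
  simp_rw [apply_ite C, map_one, map_zero, ite_mul, one_mul, zero_mul]
  rw [Finset.sum_ite_eq']
  simp

/-- **Block coefficients of the polarised permanent.** For a block `B` of `m` slots, the
coefficient of `y^B` in `θ(per_m) = ∑_σ ∏_j ∑_k y_(k, σ j, j)` is `1` if the slots of `B` have `m`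
distinct rows and `m` distinct columns, and `0` otherwise. -/
theorem coeff_indicator_theta_perPoly {t m : ℕ} (B : Finset (Fin t × Fin m × Fin m))
    (hB : B.card = m) :
    coeff (∑ s ∈ B, Finsupp.single s 1)
        (aeval (fun ℓ : Fin m × Fin m => ∑ k : Fin t,
          (X (k, ℓ) : MvPolynomial (Fin t × Fin m × Fin m) ℂ)) (perPoly (Fin m) ℂ)) =
      if (B.image fun s => s.2.1).card = m ∧ (B.image fun s => s.2.2).card = m then 1 else 0 := by
  classical
  -- expand the permanent and polarise
  have hper : perPoly (Fin m) ℂ = ∑ σ : Equiv.Perm (Fin m), ∏ j, (X (σ j, j) :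
      MvPolynomial (Fin m × Fin m) ℂ) := by
    rw [perPoly, Matrix.permanent]; rfl
  rw [hper, map_sum]
  simp_rw [map_prod, aeval_X]
  have hlin : ∀ σ : Equiv.Perm (Fin m), (∏ j, ∑ k : Fin t,
      (X (k, σ j, j) : MvPolynomial (Fin t × Fin m × Fin m) ℂ)) =
      ∏ j : Fin m, ∑ s : Fin t × Fin m × Fin m,
        C (if s.2 = (σ j, j) then (1 : ℂ) else 0) * X s := fun σ =>
    Finset.prod_congr rfl fun j _ => (sum_ite_label_eq (σ j, j)).symm
  simp_rw [hlin, coeff_sum, coeff_indicator_prod_linearForms B hB, Finset.prod_boole]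
  -- count the pairs `(σ, q)` with `label (q j) = (σ j, j)` for all `j`
  by_cases hgood : (B.image fun s => s.2.1).card = m ∧ (B.image fun s => s.2.2).card = m
  · rw [if_pos hgood]
    -- columns and rows are injective on `B`
    have hcol : Function.Injective (fun s : ↥B => (s : Fin t × Fin m × Fin m).2.2) := by
      have h := Finset.card_image_iff.1 (hgood.2.trans hB.symm)
      intro a b hab
      exact Subtype.ext (h a.2 b.2 hab)
    have hrow : Function.Injective (fun s : ↥B => (s : Fin t × Fin m × Fin m).2.1) := by
      have h := Finset.card_image_iff.1 (hgood.1.trans hB.symm)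
      intro a b hab
      exact Subtype.ext (h a.2 b.2 hab)
    have hcolbij : Function.Bijective (fun s : ↥B => (s : Fin t × Fin m × Fin m).2.2) := by
      rw [Fintype.bijective_iff_injective_and_card]
      exact ⟨hcol, by simp [hB]⟩
    set qc : Fin m ≃ ↥B := (Equiv.ofBijective _ hcolbij).symm with hqc
    have hqc_col : ∀ j, ((qc j : ↥B) : Fin t × Fin m × Fin m).2.2 = j := fun j =>
      Equiv.ofBijective_apply_symm_apply _ hcolbij j
    have hσbij : Function.Bijective (fun j => ((qc j : ↥B) : Fin t × Fin m × Fin m).2.1) := by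
      rw [← Finite.injective_iff_bijective]
      exact hrow.comp qc.injective
    set σ₀ : Equiv.Perm (Fin m) := Equiv.ofBijective _ hσbij with hσ₀
    -- uniqueness of the pair `(σ₀, qc)`
    have huniq : ∀ (σ : Equiv.Perm (Fin m)) (q : Fin m ≃ ↥B),
        (∀ j ∈ (Finset.univ : Finset (Fin m)), ((q j : ↥B) : Fin t × Fin m × Fin m).2 = (σ j, j)) →
          q = qc ∧ σ = σ₀ := by
      intro σ q h'
      have h : ∀ j, ((q j : ↥B) : Fin t × Fin m × Fin m).2 = (σ j, j) := fun j =>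
        h' j (Finset.mem_univ j)
      have hq : q = qc := by
        refine Equiv.ext fun j => hcol ?_
        change ((q j : ↥B) : Fin t × Fin m × Fin m).2.2 = ((qc j : ↥B) : Fin t × Fin m × Fin m).2.2
        rw [hqc_col, h j]
      refine ⟨hq, Equiv.ext fun j => ?_⟩
      change σ j = ((qc j : ↥B) : Fin t × Fin m × Fin m).2.1
      rw [← hq, h j]
    rw [Finset.sum_eq_single σ₀]
    · rw [Finset.sum_eq_single qc]
      · rw [if_pos]
        intro j _
        exact Prod.ext rfl (hqc_col j)
      · intro q _ hq
        exact if_neg fun h => hq (huniq σ₀ q h).1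
      · intro h; exact absurd (Finset.mem_univ _) h
    · intro σ _ hσ
      exact Finset.sum_eq_zero fun q _ => if_neg fun h => hσ (huniq σ q h).2
    · intro h; exact absurd (Finset.mem_univ _) h
  · rw [if_neg hgood]
    refine Finset.sum_eq_zero fun σ _ => Finset.sum_eq_zero fun q _ => if_neg fun h => hgood ?_
    have hcolimg : (B.image fun s => s.2.2) = Finset.univ := by
      refine Finset.eq_univ_of_forall fun j => Finset.mem_image.2 ⟨(q j : ↥B), (q j).2, ?_⟩
      rw [h j (Finset.mem_univ j)]
    have hrowimg : (B.image fun s => s.2.1) = Finset.univ := by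
      refine Finset.eq_univ_of_forall fun i => Finset.mem_image.2
        ⟨(q (σ.symm i) : ↥B), (q (σ.symm i)).2, ?_⟩
      rw [h (σ.symm i) (Finset.mem_univ _)]
      exact σ.apply_symm_apply i
    rw [hcolimg, hrowimg, Finset.card_univ, Fintype.card_fin]
    exact ⟨rfl, rfl⟩

/-! ## 6. The trace side: linear entries and the slot pencil -/

/-- A linear form is the sum of its coefficients times the variables. -/
theorem eq_sum_coeff_single_mul_X {σ : Type*} [Fintype σ] [DecidableEq σ] {f : MvPolynomial σ ℂ}
    (hf : f.IsHomogeneous 1) :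
    f = ∑ p, C (coeff (Finsupp.single p 1) f) * (X p : MvPolynomial σ ℂ) := by
  classical
  symm
  ext d
  simp only [coeff_sum, coeff_C_mul, coeff_X, mul_ite, mul_one, mul_zero]
  by_cases hd : ∃ p, Finsupp.single p 1 = d
  · obtain ⟨p, rfl⟩ := hd
    rw [Finset.sum_eq_single p (fun q _ hq => if_neg fun h =>
      hq (Finsupp.single_left_injective one_ne_zero h)) (fun h => absurd (Finset.mem_univ p) h),
      if_pos rfl]
  · rw [Finset.sum_eq_zero fun p _ => if_neg fun h => hd ⟨p, h⟩]
    refine (hf.coeff_eq_zero fun hdeg => hd ?_).symm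
    obtain ⟨p, hp⟩ := (Finsupp.sum_eq_one_iff d).mp hdeg
    exact ⟨p, hp.symm⟩

/-- **Polarisation of a matrix of linear forms is a slot pencil**: applying
`θ : x_ℓ ↦ ∑_k y_(k,ℓ)` entrywise to `A` gives `Ã = ∑_s y_s N_s` with `N_(k,ℓ) = ∂A/∂x_ℓ`. -/
theorem map_theta_eq_pencil {t m n : ℕ} (A : Matrix (Fin n) (Fin n) (MvPolynomial (Fin m × Fin m) ℂ))
    (hA : ∀ i j, (A i j).IsHomogeneous 1) :
    A.map (aeval (fun ℓ : Fin m × Fin m => ∑ k : Fin t,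
        (X (k, ℓ) : MvPolynomial (Fin t × Fin m × Fin m) ℂ))) =
      Matrix.of fun a b : Fin n => ∑ s : Fin t × Fin m × Fin m,
        C (coeff (Finsupp.single s.2 1) (A a b)) * (X s : MvPolynomial (Fin t × Fin m × Fin m) ℂ) := by
  refine Matrix.ext fun a b => ?_
  rw [Matrix.map_apply, Matrix.of_apply]
  conv_lhs => rw [eq_sum_coeff_single_mul_X (hA a b)]
  rw [map_sum]
  simp_rw [map_mul, aeval_C, aeval_X, algebraMap_eq]
  conv_rhs => rw [Fintype.sum_prod_type, Finset.sum_comm]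
  refine Finset.sum_congr rfl fun ℓ _ => ?_
  rw [Finset.mul_sum]

end Summit.ValiantsHypothesis.ValiantsHypothesis.Theorems.SchenstedIndex

end
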